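import Summits.QuantumAdvantage.QuantumAdvantage.Theses.LinnikCubicClassGroups

/-!
# QuantumAdvantage / LinnikCubicClassGroups — `Assembly` (stmt-QuantumAdvantage-12412)

The assembly item of route `LinnikCubicClassGroups`:

`DegreeOnePrimesEscape → PureCubicClassGroupFBQP → BitwiseSearchToDecision →
PureCubicClassNumberHard → QuantumAdvantage`.

This is the route's planner-authored, sorry-free deciding theorem
`Summit.QuantumAdvantage.QuantumAdvantage.Theses.LinnikCubicClassGroups.closes`
(hypotheses `hT : PureCubicClassNumberHard`, `h2 : DegreeOnePrimesEscape`,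
`h4 : PureCubicClassGroupFBQP`, `h5 : BitwiseSearchToDecision`) with its hypotheses permuted, so
the proof is a reordering of arguments. Mathematical content (all inside `closes`):
`PureCubicClassGroupFBQP` applied to `DegreeOnePrimesEscape` gives `f ∈ FBQP` of output length
`2|x|+8` printing the low class-number bits of `ℚ(∛m)`; if the summit `QuantumAdvantage`
(`∃ L ∈ BQP, L ∉ BPP`) failed then classically `BQP ⊆ BPP`, and `BitwiseSearchToDecision`
turns `f` into a PPT algorithm, contradicting the hypothesis-type target
`PureCubicClassNumberHard`.

Nothing else is proved here; the cruxes, the support items and the target are separate items of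
the route.
-/

-- D-0017: single-problem summit ⇒ `QuantumAdvantage.QuantumAdvantage` by design
set_option linter.dupNamespace false

namespace Summit.QuantumAdvantage.QuantumAdvantage.Theorems.LinnikCubicClassGroups

/-- Settles `stmt-QuantumAdvantage-12412` (route `LinnikCubicClassGroups`, assembly):
`DegreeOnePrimesEscape → PureCubicClassGroupFBQP → BitwiseSearchToDecision →
PureCubicClassNumberHard → QuantumAdvantage`, by the route's deciding theorem `closes` with its
hypotheses reordered (pure logic: under `¬ QuantumAdvantage` one has `BQP ⊆ BPP`, and
search-to-decision makes the FBQP class-number function PPT-computable, contradicting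
`PureCubicClassNumberHard`). -/
theorem Assembly_proof :
    Summit.QuantumAdvantage.QuantumAdvantage.Theses.LinnikCubicClassGroups.Assembly := by
  unfold Summit.QuantumAdvantage.QuantumAdvantage.Theses.LinnikCubicClassGroups.Assembly
  intro h2 h4 h5 hT
  exact Summit.QuantumAdvantage.QuantumAdvantage.Theses.LinnikCubicClassGroups.closes hT h2 h4 h5

end Summit.QuantumAdvantage.QuantumAdvantage.Theorems.LinnikCubicClassGroups
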